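import Literature.NumberTheory.Automorphic.UnitaryGroupLocalIntegralMembership
import Literature.NumberTheory.GelbartRogawski1991.LocalDoubledUnitaryLagrangians

/-!
# The hyperbolic swap of an integral frame lies in `H(𝒪_v)`: `w₀ = 1 + (r − r′) ⊗ h(r − r′, ·)` has integral entries when `r`, `r′` and the Gram
# matrix do (LOCAL SEAM of s23, inert package, organ (L24-b) (Λ-c))

Track B ∕ K2-LIT, hLiu418 = stmt-HodgeConjecture-24832; LEAD F0P6-plan (g11) «M-155g» (ii) ∕ «M-155i» ((L24-b) by ROAD A′).  Helper (count-neutral,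
own head per LEAD R3).  THEOREMS ONLY (no `def`, no instance, no notation, no named fact, no `sorry`).  This is the hypothesis `hw₀K : w₀ ∈ H(𝒪_v)` of
★ (Λ-b) `K2LiuDoublingEigenfunctionalNonvanishing.apply_zero_toRep_mul_localSplitting_boxSB_unitVec_ne_zero` for ★ (C3′)'s swap element
`w₀ = localSwapElt … (hermForm_localFormD_swapVector … hyy hsy hys)` of a hyperbolic frame `(y, y*)` whose coordinates over `E ⊗ F_v = Π_{w∣v} E_w` are
INTEGRAL (★ `IsIntegralLoc`), at a place where the Gram matrix `T₀` is integral (★ `IsGoodPlace.gram`).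

* §1 (any `E/F`, any form `H` over `S = E ⊗ F_v`): `isIntegralLoc_hermRow` (`h(x, e_j)` integral for `x`, `H` integral), `isIntegralLoc_lineSwapGL_apply`
  (the entries of ★ `lineSwapGL` = ★ `lineRoot σ H (r − r′) 0 1`), **`localSwapElt_mem_localInt`** (★ `localPiEquiv_symm_mem_localInt` — `w₀⁻¹ = w₀`).
* §2 (the doubled datum `J^𝔻 = (T₀ ⊕ −T₀) ⊗ 1`): `isIntegralLoc_gramS_apply` (from ★ `IsGoodPlace`-style integrality of `T₀`), `isIntegralLoc_localFormD_apply`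
  (★ `localFormD_eq`), `isIntegralLoc_swapVector_apply`, and **`localSwapElt_swapVector_mem_localInt`** — ★ (C3′)'s `w₀` lies in `H(𝒪_v)` when `y`, `y*` are
  integral and `T₀` is integral at `v`.
[Dieudonne1971GroupesClassiques, Chap. II §5]; [PlatonovRapinchuk1994, §5.1]; [GelbartRogawski1991, §3.1 (3.1.3) p. 456].
HONEST LABEL: HC_CM is proved only modulo the printed citations (2 remaining named inputs: hLiu418 = stmt-HodgeConjecture-24832, h413 =
stmt-HodgeConjecture-24833) until rung 0 closes; this file is unconditional and moves no counter.
-/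

set_option autoImplicit false

set_option linter.dupNamespace false

noncomputable section

open scoped Matrix
open NumberField IsDedekindDomain Matrix
open Literature.NumberTheory.Automorphic Literature.NumberTheory.Automorphic.UnitaryGroup
open Literature.NumberTheory.GelbartRogawski1991.UnitaryDualPair.LocalSplitting

namespace Summit.HodgeConjecture.HodgeConjecture.Cruxes.HLiu418.K2LiuIntegralSwap

variable {F : Type} [Field F] [NumberField F] (E : Type) [Field E] [NumberField E] [Algebra F E]
  (c : E ≃ₐ[F] E) (v : HeightOneSpectrum (𝓞 F))

/-! ## §1 Integral entries of the swap -/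

section Swap

variable {N : ℕ}

/-- `h(x, e_j) = Σ_k σ(x_k) H_{kj}` is integral when `x` and `H` are. [cite: CasselsFrohlichANT1967, Ch. II §10] -/
theorem isIntegralLoc_hermRow {H : Matrix (Fin N) (Fin N) (LocalRing E v)} (hH : ∀ i j, IsIntegralLoc F E v (H i j))
    {x : Fin N → LocalRing E v} (hx : ∀ i, IsIntegralLoc F E v (x i)) (j : Fin N) :
    IsIntegralLoc F E v (hermRow (conjLocal E c v) H x j) := by
  have h : hermRow (conjLocal E c v) H x j = ∑ k, conjLocal E c v (x k) * H k j := rfl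
  rw [h]
  exact IsIntegralLoc.sum _ fun k _ => (IsIntegralLoc.conj c (hx k)).mul (hH k j)

/-- **the entries of the swap `w₀ = 1 + (r − r′) ⊗ h(r − r′, ·)` are integral** when `r`, `r′`, `H` are.
[cite: Dieudonne1971GroupesClassiques, Chap. II §5] [cite: PlatonovRapinchuk1994, §5.1] -/
theorem isIntegralLoc_lineSwapGL_apply {H : Matrix (Fin N) (Fin N) (LocalRing E v)} (hH : ∀ i j, IsIntegralLoc F E v (H i j))
    {r r' : Fin N → LocalRing E v} (hr : ∀ i, IsIntegralLoc F E v (r i)) (hr' : ∀ i, IsIntegralLoc F E v (r' i))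
    (h2 : hermForm (conjLocal E c v) H (r - r') (r - r') = -2) (i j : Fin N) :
    IsIntegralLoc F E v ((lineSwapGL (conjLocal E c v) H h2).val i j) := by
  have hu : ∀ k, IsIntegralLoc F E v ((r - r') k) := fun k => by rw [Pi.sub_apply]; exact (hr k).sub (hr' k)
  have h0 : ∀ k, IsIntegralLoc F E v ((0 : Fin N → LocalRing E v) k) := fun k => IsIntegralLoc.zero
  rw [coe_lineSwapGL, lineRoot, Matrix.add_apply, Matrix.add_apply, Matrix.vecMulVec_apply, Matrix.vecMulVec_apply]
  have h1 : ((1 : LocalRing E v) • hermRow (conjLocal E c v) H (r - r') - hermRow (conjLocal E c v) H 0) j =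
      hermRow (conjLocal E c v) H (r - r') j - hermRow (conjLocal E c v) H 0 j := by
    rw [Pi.sub_apply, Pi.smul_apply, one_smul]
  rw [h1]
  exact ((isIntegralLoc_one_apply E v i j).add ((h0 i).mul (isIntegralLoc_hermRow E c v hH hu j))).add
    ((hu i).mul ((isIntegralLoc_hermRow E c v hH hu j).sub (isIntegralLoc_hermRow E c v hH h0 j)))

variable (N) (J : Matrix (Fin N) (Fin N) E) {δ : E} (hcδ : c δ = -δ) (hδ : δ ≠ 0)

/-- **the swap of an integral pair lies in `U(J)(𝒪_v)`**: for `r`, `r′` integral over `E ⊗ F_v` and the local Gram matrix `(J ⊗ 1)_v` integral,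
★ `localSwapElt … h2 ∈ localInt` (integral matrix, `w₀⁻¹ = w₀`; ★ `localPiEquiv_symm_mem_localInt`).
[cite: Dieudonne1971GroupesClassiques, Chap. II §5] [cite: PlatonovRapinchuk1994, §5.1] -/
theorem localSwapElt_mem_localInt [Algebra.IsQuadraticExtension F E] (hJh : (J.map c)ᵀ = J)
    (hH : ∀ i j, IsIntegralLoc F E v (((adelicForm E N J).map (adeleToLocal E v)) i j))
    {r r' : Fin N → LocalRing E v} (hr : ∀ i, IsIntegralLoc F E v (r i)) (hr' : ∀ i, IsIntegralLoc F E v (r' i))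
    (h2 : hermForm (conjLocal E c v) ((adelicForm E N J).map (adeleToLocal E v)) (r - r') (r - r') = -2) :
    localSwapElt E c N J v hcδ hδ hJh h2 ∈ UnitaryGroup.localInt E c N J v := by
  rw [localSwapElt]
  refine localPiEquiv_symm_mem_localInt E c N J v _ (fun i j => isIntegralLoc_lineSwapGL_apply E c v hH hr hr' h2 i j) fun i j => ?_
  rw [Subgroup.coe_inv, lineSwapGL_inv]
  exact isIntegralLoc_lineSwapGL_apply E c v hH hr hr' h2 i j

end Swap

/-! ## §2 The doubled datum: ★ (C3′)'s swap of an integral hyperbolic frame lies in `H(𝒪_v)` -/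

section Doubled

variable (n : ℕ) {T₀ : Matrix (Fin n) (Fin n) F}
  {JD : Matrix (Fin (n + n)) (Fin (n + n)) E} (hJD : JD = (gramD F n T₀).map (algebraMap F E))
  {δ : E} (hcδ : c δ = -δ) (hδ : δ ≠ 0)

/-- `G = T₀ ⊗ 1` has integral entries over `E ⊗ F_v` when `T₀` is integral at every `w ∣ v` (the shape of ★ `IsGoodPlace.gram`).
[cite: GelbartRogawski1991, §3.1 (3.1.3) p. 456] -/
theorem isIntegralLoc_gramS_apply
    (hT : ∀ (w : PlacesOver E v) (i j : Fin n),
      ValuativeRel.valuation (w.1.adicCompletion E) (algebraMap E (w.1.adicCompletion E) (algebraMap F E (T₀ i j))) ≤ 1)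
    (i j : Fin n) : IsIntegralLoc F E v (gramS F E v n T₀ i j) := by
  intro w
  have h : gramS F E v n T₀ i j w = algebraMap E (w.1.adicCompletion E) (algebraMap F E (T₀ i j)) := by
    simp only [Matrix.map_apply, toLocalRing_apply, HeightOneSpectrum.algebraMap_adicCompletion, Function.comp_apply, Algebra.algebraMap_self,
      RingHom.id_apply, toPlace_coe]
  rw [h]
  exact hT w i j

include hJD in
/-- the doubled local form `(J^𝔻 ⊗ 1)_v = e₂ (G ⊕ −G) e₂` has integral entries when `G` does. [cite: HarrisKudlaSweet1996, §1 (1.9)] -/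
theorem isIntegralLoc_localFormD_apply (hG : ∀ i j, IsIntegralLoc F E v (gramS F E v n T₀ i j)) (i j : Fin (n + n)) :
    IsIntegralLoc F E v (((adelicForm E (n + n) JD).map (adeleToLocal E v)) i j) := by
  rw [localFormD_eq F E v n hJD, Matrix.reindex_apply, Matrix.submatrix_apply]
  rcases (e₂ n).symm i with a | a <;> rcases (e₂ n).symm j with b | b
  · rw [Matrix.fromBlocks_apply₁₁]; exact hG a b
  · rw [Matrix.fromBlocks_apply₁₂, Matrix.zero_apply]; exact IsIntegralLoc.zero
  · rw [Matrix.fromBlocks_apply₂₁, Matrix.zero_apply]; exact IsIntegralLoc.zero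
  · rw [Matrix.fromBlocks_apply₂₂, Matrix.neg_apply]; exact (hG a b).neg

omit [NumberField F] in
/-- the swap vector `e − f`, `e = (y*, y*)`, `f = (y, 0)`, has integral coordinates when `y`, `y*` do. [cite: Dieudonne1971GroupesClassiques, Chap. II §5] -/
theorem isIntegralLoc_swapVector_apply {y ys : Fin n → LocalRing E v} (hy : ∀ i, IsIntegralLoc F E v (y i))
    (hys : ∀ i, IsIntegralLoc F E v (ys i)) (k : Fin (n + n)) :
    IsIntegralLoc F E v ((Sum.elim ys ys ∘ ⇑(e₂ n).symm) k) ∧ IsIntegralLoc F E v ((Sum.elim y 0 ∘ ⇑(e₂ n).symm) k) := by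
  simp only [Function.comp_apply]
  rcases (e₂ n).symm k with a | a
  · exact ⟨by rw [Sum.elim_inl]; exact hys a, by rw [Sum.elim_inl]; exact hy a⟩
  · exact ⟨by rw [Sum.elim_inr]; exact hys a, by rw [Sum.elim_inr, Pi.zero_apply]; exact IsIntegralLoc.zero⟩

include hJD in
/-- **★ (C3′)'s SWAP ELEMENT LIES IN `H(𝒪_v)`** when the hyperbolic frame `(y, y*)` is integral over `E ⊗ F_v` and `T₀` is integral at `v`:
`localSwapElt … (e − f) ∈ localInt …` — the hypothesis `hw₀K` of ★ (Λ-b). [cite: Dieudonne1971GroupesClassiques, Chap. II §5]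
[cite: PlatonovRapinchuk1994, §5.1] [cite: GelbartRogawski1991, §3.1 (3.1.3) p. 456] -/
theorem localSwapElt_swapVector_mem_localInt [Algebra.IsQuadraticExtension F E] (hJh : (JD.map c)ᵀ = JD)
    (hT : ∀ (w : PlacesOver E v) (i j : Fin n),
      ValuativeRel.valuation (w.1.adicCompletion E) (algebraMap E (w.1.adicCompletion E) (algebraMap F E (T₀ i j))) ≤ 1)
    {y ys : Fin n → LocalRing E v} (hy : ∀ i, IsIntegralLoc F E v (y i)) (hys : ∀ i, IsIntegralLoc F E v (ys i))
    (h2 : hermForm (conjLocal E c v) ((adelicForm E (n + n) JD).map (adeleToLocal E v))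
      (Sum.elim ys ys ∘ ⇑(e₂ n).symm - Sum.elim y 0 ∘ ⇑(e₂ n).symm)
      (Sum.elim ys ys ∘ ⇑(e₂ n).symm - Sum.elim y 0 ∘ ⇑(e₂ n).symm) = -2) :
    localSwapElt E c (n + n) JD v hcδ hδ hJh h2 ∈ UnitaryGroup.localInt E c (n + n) JD v :=
  localSwapElt_mem_localInt E c v (n + n) JD hcδ hδ hJh
    (isIntegralLoc_localFormD_apply E v n hJD (isIntegralLoc_gramS_apply E v n hT))
    (fun k => (isIntegralLoc_swapVector_apply E v n hy hys k).1) (fun k => (isIntegralLoc_swapVector_apply E v n hy hys k).2) h2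

end Doubled

end Summit.HodgeConjecture.HodgeConjecture.Cruxes.HLiu418.K2LiuIntegralSwap

end
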